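import Summits.Ventures.Crystal3D.Theorems.StickyWulffConstantGenericWallFloorStackWalkRigidity
import Summits.Ventures.Crystal3D.Theorems.StickyWulffConstantCoaxialWallLawTriadicLattice
import Summits.Ventures.Crystal3D.Theorems.StickyWulffConstantGenericWallFloorChainTerminalClass
import Summits.Ventures.Crystal3D.Theorems.StickyWulffConstantGenericWallFloorCommonSlots
import Summits.Ventures.Crystal3D.Theorems.StickyWulffConstantGenericWallFloorMixedDozenRules
import Summits.Ventures.Crystal3D.Theorems.StickyWulffConstantTextureLiminfTentFrameWulff
import Summits.Ventures.Crystal3D.Theorems.StickyWulffConstantCoaxialWallLawOneFccFluxC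
import Summits.Ventures.Crystal3D.Theorems.StickyWulffConstantTextureBuildFccCell
import HarnessLib

/-!
# The column word lemma, I: AFFINE lattices and the affine twin step (input (I5) = (P3)/(L4) of the terrace census,
# cf-p1 RULINGS (ccxxxv)(iii), (ccxli); lane T `TexShadow`, registered stub `stub_terraceCensus`, crux `TextureLiminfV5`)

HONEST FRAMING. Venture `Summits/Ventures/Crystal3D` (cell `crystal3d-full`), route `route-Ventures-StickyWulffConstant`, helper
`--supports` the law-v5 crux `TextureLiminfV5` (stmt-Ventures-23912), lane T, mechanism (β) (memos LAMELLA-CENSUS-g17 §1 (P3),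
BETA-ASSEMBLY-g18 §2 (L4)); owner of input (I5) `stub_columnWord`: 19480-p2 g15.  PURE LATTICE ALGEBRA — census-free, standard axioms,
nothing about configurations; its import closure avoids the 32 poisoned modules of RULING (ccxxxix) (probe run).  F-C1 not moved.

THE POINT.  A saturated column of the filling carries, ball by ball, an AFFINE lattice `(A· + t) '' fccRef` (the currency of
`BilayerFramesAt`: frame `A`, origin `t`).  Crossing a coherent twin plane through the ball `b` with unit normal `n` replaces it by its
mirror image — again an affine lattice, with frame `twinFrame A n` and origin `t + 2⟪b − t, n⟫·n` (`reflect_affine_eq`,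
`image_reflect_affLat`).  When `n` is a MENU normal of `A` (a `{111}` normal of the lattice `A·Λ₀`) the crossed layer index
`⟪b − t, n⟫/√(2/3)` is an integer (`exists_int_inner_sub_origin`), and the affine class of the twin depends on it only MOD 3:
`2j√(2/3)·n ∈ A·Λ₀ ↔ 3 ∣ j` (`two_mul_sqrt_smul_menu_mem_iff` — by `‖x‖² ∈ ℤ` on `Λ₀` and `√6·n ∈ A·Λ₀`), whence
`affLat_twin_eq_iff_modEq` (two offsets of the same plane family give the same affine twin iff they are `≡ (mod 3)`) and the
CANCELLING PAIR law `affLat_cancel_eq_iff` (crossing the same family twice returns the linear frame, and returns the affine lattice iff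
the two signed layer indices sum to a multiple of 3 — a complete twin band is free for the word and shifts the coset otherwise).
Also: PLATE MATCHING — `affLat_eq_iff` (`(A· + t)''Λ₀ = (B· + s)''Λ₀ ↔ A·Λ₀ = B·Λ₀ ∧ s − t ∈ A·Λ₀`), `affLat_eq_of_mem_of_image_eq`,
and the LOCAL form `affLat_eq_of_dozen_subset` (an affine lattice containing a ball of another one together with its twelve slot
neighbours IS that lattice) — how a column ending inside plate 2 is identified with plate 2's affine lattice.
WHAT THIS IS NOT: the word / free-reduction half (…ColumnWordReduce, …ColumnWord) and the configuration-level Def of (I5); F-C1 not moved.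
-/

noncomputable section

namespace Summit.Ventures.Crystal3D.Theorems

namespace ColumnWord

open Summit.Ventures.Crystal3D
open Summit.Ventures.Crystal3D.Cruxes.TextureLiminf.TexShadow (E3 fccRef add_mem_fccRef)
open Summit.Ventures.Crystal3D.TentCertificate (zero_mem_fccRef sub_mem_fccRef neg_mem_fccRef)
open Literature.MathematicalPhysics.StatisticalMechanics (fccStacking)
open scoped InnerProductSpace

/-! ### Affine lattices `(A· + t) '' fccRef` -/

/-- `fccRef` unfolds to the tree's `Λ₀ = fccStacking 1 √(2/3)`. -/
theorem fccRef_def : fccRef = fccStacking 1 (Real.sqrt (2 / 3)) := rfl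

/-- Differences of two points of an affine lattice lie in its linear lattice. -/
theorem sub_mem_image_of_mem_affLat {A : E3 ≃ₗᵢ[ℝ] E3} {t x y : E3} (hx : x ∈ (fun r => A r + t) '' fccRef)
    (hy : y ∈ (fun r => A r + t) '' fccRef) : x - y ∈ A '' fccRef := by
  obtain ⟨r, hr, rfl⟩ := hx
  obtain ⟨r', hr', rfl⟩ := hy
  exact ⟨r - r', sub_mem_fccRef hr hr', by simp [map_sub]⟩

/-- Membership in an affine lattice relative to one of its points: `y ∈ (A· + t)''Λ₀ ↔ y − x ∈ A·Λ₀` for `x ∈ (A· + t)''Λ₀`. -/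
theorem mem_affLat_iff_sub_mem {A : E3 ≃ₗᵢ[ℝ] E3} {t x : E3} (hx : x ∈ (fun r => A r + t) '' fccRef) (y : E3) :
    y ∈ (fun r => A r + t) '' fccRef ↔ y - x ∈ A '' fccRef := by
  refine ⟨fun hy => sub_mem_image_of_mem_affLat hy hx, fun hy => ?_⟩
  obtain ⟨r, hr, hxr⟩ := hx
  obtain ⟨q, hq, hq'⟩ := hy
  refine ⟨q + r, add_mem_fccRef hq hr, ?_⟩
  simp only at hxr
  show A (q + r) + t = y
  rw [map_add, add_assoc, hxr, hq', sub_add_cancel]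

/-- The origin is a point of the affine lattice. -/
theorem origin_mem_affLat (A : E3 ≃ₗᵢ[ℝ] E3) (t : E3) : t ∈ (fun r => A r + t) '' fccRef :=
  ⟨0, zero_mem_fccRef, by simp⟩

/-- **Two affine lattices with the same linear lattice sharing a point are equal.** -/
theorem affLat_eq_of_mem_of_image_eq {A B : E3 ≃ₗᵢ[ℝ] E3} {t s x : E3} (hAB : A '' fccRef = B '' fccRef)
    (hxA : x ∈ (fun r => A r + t) '' fccRef) (hxB : x ∈ (fun r => B r + s) '' fccRef) :
    (fun r => A r + t) '' fccRef = (fun r => B r + s) '' fccRef := by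
  ext y
  rw [mem_affLat_iff_sub_mem hxA, mem_affLat_iff_sub_mem hxB, hAB]

/-- **PLATE MATCHING (global form).**  `(A· + t)''Λ₀ = (B· + s)''Λ₀ ↔ A·Λ₀ = B·Λ₀ ∧ s − t ∈ A·Λ₀`. -/
theorem affLat_eq_iff (A B : E3 ≃ₗᵢ[ℝ] E3) (t s : E3) :
    (fun r => A r + t) '' fccRef = (fun r => B r + s) '' fccRef ↔ A '' fccRef = B '' fccRef ∧ s - t ∈ A '' fccRef := by
  constructor
  · intro h
    have htB : t ∈ (fun r => B r + s) '' fccRef := h ▸ origin_mem_affLat A t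
    have hsA : s ∈ (fun r => A r + t) '' fccRef := h.symm ▸ origin_mem_affLat B s
    have hlin : A '' fccRef = B '' fccRef := by
      ext v
      constructor
      · rintro ⟨r, hr, rfl⟩
        have h1 : A r + t ∈ (fun r => B r + s) '' fccRef := h ▸ ⟨r, hr, rfl⟩
        simpa using sub_mem_image_of_mem_affLat h1 htB
      · rintro ⟨r, hr, rfl⟩
        have h1 : B r + s ∈ (fun r => A r + t) '' fccRef := h.symm ▸ ⟨r, hr, rfl⟩
        simpa using sub_mem_image_of_mem_affLat h1 hsA
    exact ⟨hlin, sub_mem_image_of_mem_affLat hsA (origin_mem_affLat A t)⟩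
  · rintro ⟨hlin, hst⟩
    refine affLat_eq_of_mem_of_image_eq (x := s) hlin ?_ (origin_mem_affLat B s)
    rw [mem_affLat_iff_sub_mem (origin_mem_affLat A t)]
    exact hst

/-- **PLATE MATCHING (local form): a ball and its dozen determine the affine lattice.**  If `x` lies in both affine lattices and the
twelve slot neighbours `x + A w` (`w ∈ fccSlots`) of `x` in the first lie in the second, the two affine lattices are equal. -/
theorem affLat_eq_of_dozen_subset {A B : E3 ≃ₗᵢ[ℝ] E3} {t s x : E3} (hxA : x ∈ (fun r => A r + t) '' fccRef)
    (hxB : x ∈ (fun r => B r + s) '' fccRef) (hdoz : ∀ w ∈ fccSlots, x + A w ∈ (fun r => B r + s) '' fccRef) :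
    (fun r => A r + t) '' fccRef = (fun r => B r + s) '' fccRef := by
  classical
  -- every `A`-slot is a `B`-slot
  have hsub : fccSlots.image (fun w => A w) ⊆ fccSlots.image (fun w => B w) := by
    intro v hv
    obtain ⟨w, hw, rfl⟩ := Finset.mem_image.1 hv
    have hmem : A w ∈ B '' fccRef := by simpa using sub_mem_image_of_mem_affLat (hdoz w hw) hxB
    obtain ⟨w', hw', he⟩ := exists_slot_of_unit_mem B (by rw [fccRef_def] at hmem; exact hmem)
      (by rw [LinearIsometryEquiv.norm_map, norm_eq_one_of_mem_fccSlots hw])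
    exact Finset.mem_image.2 ⟨w', hw', he⟩
  have hcardA : (fccSlots.image (fun w => A w)).card = 12 := by
    rw [Finset.card_image_of_injective _ A.injective, card_fccSlots]
  have hcardB : (fccSlots.image (fun w => B w)).card = 12 := by
    rw [Finset.card_image_of_injective _ B.injective, card_fccSlots]
  have heq : fccSlots.image (fun w => A w) = fccSlots.image (fun w => B w) :=
    Finset.eq_of_subset_of_card_le hsub (by rw [hcardA, hcardB])
  have hset : (A : E3 → E3) '' ↑fccSlots = (B : E3 → E3) '' ↑fccSlots := by
    rw [← Finset.coe_image, ← Finset.coe_image, heq]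
  exact affLat_eq_of_mem_of_image_eq (image_fccRef_eq_of_image_fccSlots_eq hset) hxA hxB

/-! ### The affine twin step across the plane through `b` with unit normal `n` -/

/-- **Reflecting an affine lattice point.**  For a unit `n`, the reflection `x ↦ x − 2⟪x − b, n⟫ n` across the plane through `b`
orthogonal to `n` sends `A r + t` to `twinFrame A n r + (t + 2⟪b − t, n⟫ n)`. -/
theorem reflect_affine_eq (A : E3 ≃ₗᵢ[ℝ] E3) {n : E3} (hn : ‖n‖ = 1) (t b r : E3) :
    (A r + t) - (2 * ⟪A r + t - b, n⟫_ℝ) • n = twinFrame A n r + (t + (2 * ⟪b - t, n⟫_ℝ) • n) := by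
  rw [twinFrame_apply A hn]
  have e : ⟪A r + t - b, n⟫_ℝ = ⟪A r, n⟫_ℝ - ⟪b - t, n⟫_ℝ := by
    rw [inner_sub_left, inner_add_left, inner_sub_left]; ring
  rw [e, mul_sub, sub_smul]
  abel

/-- The reflection fixes the plane through `b`: points with `⟪x − b, n⟫ = 0` do not move. -/
theorem reflect_eq_self_of_inner_eq_zero {x b n : E3} (h : ⟪x - b, n⟫_ℝ = 0) : x - (2 * ⟪x - b, n⟫_ℝ) • n = x := by
  rw [h, mul_zero, zero_smul, sub_zero]

/-- **The mirror image of an affine lattice is the affine lattice of the twin frame** with origin `t + 2⟪b − t, n⟫ n`. -/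
theorem image_reflect_affLat (A : E3 ≃ₗᵢ[ℝ] E3) {n : E3} (hn : ‖n‖ = 1) (t b : E3) :
    (fun x => x - (2 * ⟪x - b, n⟫_ℝ) • n) '' ((fun r => A r + t) '' fccRef) =
      (fun r => twinFrame A n r + (t + (2 * ⟪b - t, n⟫_ℝ) • n)) '' fccRef := by
  rw [Set.image_image]
  exact Set.image_congr fun r _ => reflect_affine_eq A hn t b r

/-- A menu normal of `A` is a menu normal of the twin frame `twinFrame A n` (the mirror negates `⟪·, n⟫`). -/
theorem menu_twinFrame {A : E3 ≃ₗᵢ[ℝ] E3} {n : E3} (hn : ‖n‖ = 1)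
    (hmenu : ∀ w ∈ fccSlots, ⟪A w, n⟫_ℝ = 0 ∨ ⟪A w, n⟫_ℝ = Real.sqrt (2 / 3) ∨ ⟪A w, n⟫_ℝ = -Real.sqrt (2 / 3)) :
    ∀ w ∈ fccSlots, ⟪twinFrame A n w, n⟫_ℝ = 0 ∨ ⟪twinFrame A n w, n⟫_ℝ = Real.sqrt (2 / 3) ∨
      ⟪twinFrame A n w, n⟫_ℝ = -Real.sqrt (2 / 3) := by
  intro w hw
  have e : ⟪twinFrame A n w, n⟫_ℝ = -⟪A w, n⟫_ℝ := by
    rw [twinFrame_apply A hn, inner_sub_left, real_inner_smul_left, real_inner_self_eq_norm_sq, hn]; ring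
  rcases hmenu w hw with h | h | h
  · exact Or.inl (by rw [e, h, neg_zero])
  · exact Or.inr (Or.inr (by rw [e, h]))
  · exact Or.inr (Or.inl (by rw [e, h, neg_neg]))

/-! ### Layer indices and the MOD-3 law -/

/-- **The crossed layer index is an integer**: for `b` in the affine lattice `(A· + t)''Λ₀` and a menu normal `n` of `A`,
`⟪b − t, n⟫ = j·√(2/3)` for some `j : ℤ`. -/
theorem exists_int_inner_sub_origin {A : E3 ≃ₗᵢ[ℝ] E3} {n t b : E3}
    (hmenu : ∀ w ∈ fccSlots, ⟪A w, n⟫_ℝ = 0 ∨ ⟪A w, n⟫_ℝ = Real.sqrt (2 / 3) ∨ ⟪A w, n⟫_ℝ = -Real.sqrt (2 / 3))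
    (hb : b ∈ (fun r => A r + t) '' fccRef) : ∃ j : ℤ, ⟪b - t, n⟫_ℝ = j * Real.sqrt (2 / 3) := by
  obtain ⟨r, hr, rfl⟩ := hb
  have e : A r + t - t = A r := by abel
  rw [e]
  exact inner_lattice_menu A hmenu (by rw [fccRef_def] at hr; exact hr)

/-- **MOD-3 LAW.**  For a unit menu normal `n` of `A`: `(2j√(2/3))·n ∈ A·Λ₀ ↔ 3 ∣ j`
(`‖·‖² = 8j²/3` must be an integer; conversely `6√(2/3)·n = 2·(√6 n) ∈ A·Λ₀`). -/
theorem two_mul_sqrt_smul_menu_mem_iff {A : E3 ≃ₗᵢ[ℝ] E3} {n : E3} (hn : ‖n‖ = 1)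
    (hmenu : ∀ w ∈ fccSlots, ⟪A w, n⟫_ℝ = 0 ∨ ⟪A w, n⟫_ℝ = Real.sqrt (2 / 3) ∨ ⟪A w, n⟫_ℝ = -Real.sqrt (2 / 3)) (j : ℤ) :
    ((2 * j : ℝ) * Real.sqrt (2 / 3)) • n ∈ A '' fccRef ↔ (3 : ℤ) ∣ j := by
  have hs2 : Real.sqrt (2 / 3) ^ 2 = 2 / 3 := Real.sq_sqrt (by norm_num)
  constructor
  · rintro ⟨x, hx, hxe⟩
    obtain ⟨m, hm⟩ := exists_int_norm_sq_of_mem_fcc (by rw [fccRef_def] at hx; exact hx)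
    have hnorm : ‖A x‖ ^ 2 = ((2 * j : ℝ) * Real.sqrt (2 / 3)) ^ 2 := by
      rw [hxe, norm_smul, hn, mul_one, Real.norm_eq_abs, sq_abs]
    rw [LinearIsometryEquiv.norm_map, hm] at hnorm
    -- `3 m = 8 j²`
    have h3 : (3 * m : ℤ) = 8 * j ^ 2 := by
      have : (3 * m : ℝ) = 8 * (j : ℝ) ^ 2 := by rw [hnorm, mul_pow, hs2]; ring
      exact_mod_cast this
    have hdvd : (3 : ℤ) ∣ 8 * j ^ 2 := ⟨m, by rw [← h3]⟩
    rcases Int.prime_three.dvd_mul.1 hdvd with h8 | h8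
    · norm_num at h8
    · exact Int.prime_three.dvd_of_dvd_pow h8
  · rintro ⟨k, rfl⟩
    obtain ⟨y, hy, hye⟩ := exists_lattice_eq_sqrt6_menu A hmenu
    refine ⟨((2 * k : ℤ) : ℝ) • y, ?_, ?_⟩
    · show ((2 * k : ℤ) : ℝ) • y ∈ fccStacking 1 (Real.sqrt (2 / 3))
      exact fcc_zsmul_mem (2 * k) hy
    · rw [map_smul, hye, smul_smul]
      congr 1
      have h6 : Real.sqrt 6 = 3 * Real.sqrt (2 / 3) := by
        rw [show (6 : ℝ) = 3 ^ 2 * (2 / 3) by norm_num, Real.sqrt_mul (by norm_num) (2 / 3), Real.sqrt_sq (by norm_num)]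
      rw [h6]; push_cast; ring

/-- **The affine twin depends on the crossed layer only MOD 3.**  Same plane family (unit menu normal `n` of `A`), offsets
`j, j'`: the two affine twins `(twinFrame A n · + (t + 2j√(2/3) n))''Λ₀` and `(… + 2j'√(2/3) n)''Λ₀` coincide iff `j ≡ j' (mod 3)`. -/
theorem affLat_twin_eq_iff_modEq {A : E3 ≃ₗᵢ[ℝ] E3} {n : E3} (hn : ‖n‖ = 1)
    (hmenu : ∀ w ∈ fccSlots, ⟪A w, n⟫_ℝ = 0 ∨ ⟪A w, n⟫_ℝ = Real.sqrt (2 / 3) ∨ ⟪A w, n⟫_ℝ = -Real.sqrt (2 / 3))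
    (t : E3) (j j' : ℤ) :
    (fun r => twinFrame A n r + (t + ((2 * j : ℝ) * Real.sqrt (2 / 3)) • n)) '' fccRef =
        (fun r => twinFrame A n r + (t + ((2 * j' : ℝ) * Real.sqrt (2 / 3)) • n)) '' fccRef ↔
      j ≡ j' [ZMOD 3] := by
  rw [affLat_eq_iff]
  have e : t + ((2 * j' : ℝ) * Real.sqrt (2 / 3)) • n - (t + ((2 * j : ℝ) * Real.sqrt (2 / 3)) • n) =
      ((2 * ((j' - j : ℤ) : ℝ)) * Real.sqrt (2 / 3)) • n := by
    rw [show t + ((2 * j' : ℝ) * Real.sqrt (2 / 3)) • n - (t + ((2 * j : ℝ) * Real.sqrt (2 / 3)) • n) =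
        ((2 * j' : ℝ) * Real.sqrt (2 / 3)) • n - ((2 * j : ℝ) * Real.sqrt (2 / 3)) • n by abel, ← sub_smul]
    congr 1; push_cast; ring
  rw [e, two_mul_sqrt_smul_menu_mem_iff hn (menu_twinFrame hn hmenu), Int.modEq_iff_dvd]
  simp

/-- Crossing the same plane family twice returns the LINEAR frame: `twinFrame (twinFrame A n) n' = A` for `n' = ± n`. -/
theorem twinFrame_twinFrame_of_eq_or_eq_neg (A : E3 ≃ₗᵢ[ℝ] E3) {n n' : E3} (hn : ‖n‖ = 1) (h : n' = n ∨ n' = -n) :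
    twinFrame (twinFrame A n) n' = A := by
  have key : ∀ x, twinFrame (twinFrame A n) n x = A x := by
    intro x
    have h1 : ⟪twinFrame A n x, n⟫_ℝ = -⟪A x, n⟫_ℝ := by
      rw [twinFrame_apply A hn, inner_sub_left, real_inner_smul_left, real_inner_self_eq_norm_sq, hn]; ring
    rw [twinFrame_apply _ hn, h1, twinFrame_apply A hn, mul_neg, neg_smul, sub_neg_eq_add, sub_add_cancel]
  rcases h with rfl | rfl
  · exact LinearIsometryEquiv.ext key
  · refine LinearIsometryEquiv.ext fun x => ?_
    have hneg : twinFrame (twinFrame A n) (-n) x = twinFrame (twinFrame A n) n x := by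
      rw [twinFrame_apply _ (by rw [norm_neg, hn]), twinFrame_apply (twinFrame A n) hn, inner_neg_right, mul_neg,
        neg_smul, smul_neg, neg_neg]
    rw [hneg, key]

/-- **CANCELLING PAIR (complete twin band).**  Cross the plane family `n` (unit menu normal of `A`) at the ball `b` of `(A· + t)''Λ₀`
(twin origin `t₁ = t + 2⟪b − t, n⟫ n`), then cross it again (normal `n' = ± n`) at the ball `b'` of the twin: the frame returns to `A`,
the origin becomes `t + 2(j + j')√(2/3)·n` for the two signed layer indices `j = ⟪b − t, n⟫/√(2/3)`, `j' = ⟪b' − t₁, n⟫/√(2/3)`, and the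
final affine lattice IS the initial one iff `3 ∣ j + j'` (a complete twin band is invisible to the word and shifts the coset otherwise). -/
theorem affLat_cancel_eq_iff {A : E3 ≃ₗᵢ[ℝ] E3} {n n' : E3} (hn : ‖n‖ = 1) (hn' : n' = n ∨ n' = -n)
    (hmenu : ∀ w ∈ fccSlots, ⟪A w, n⟫_ℝ = 0 ∨ ⟪A w, n⟫_ℝ = Real.sqrt (2 / 3) ∨ ⟪A w, n⟫_ℝ = -Real.sqrt (2 / 3))
    {t t₁ b b' : E3} {j j' : ℤ} (ht₁ : t₁ = t + (2 * ⟪b - t, n⟫_ℝ) • n) (hj : ⟪b - t, n⟫_ℝ = j * Real.sqrt (2 / 3))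
    (hj' : ⟪b' - t₁, n⟫_ℝ = j' * Real.sqrt (2 / 3)) :
    twinFrame (twinFrame A n) n' = A ∧
      t₁ + (2 * ⟪b' - t₁, n'⟫_ℝ) • n' = t + ((2 * ((j + j' : ℤ) : ℝ)) * Real.sqrt (2 / 3)) • n ∧
      ((fun r => twinFrame (twinFrame A n) n' r + (t₁ + (2 * ⟪b' - t₁, n'⟫_ℝ) • n')) '' fccRef =
          (fun r => A r + t) '' fccRef ↔ (3 : ℤ) ∣ j + j') := by
  have hframe := twinFrame_twinFrame_of_eq_or_eq_neg A hn hn'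
  have hsm : (2 * ⟪b' - t₁, n'⟫_ℝ) • n' = (2 * ⟪b' - t₁, n⟫_ℝ) • n := by
    rcases hn' with rfl | rfl
    · rfl
    · rw [inner_neg_right, smul_neg, mul_neg, neg_smul, neg_neg]
  have horig : t₁ + (2 * ⟪b' - t₁, n'⟫_ℝ) • n' = t + ((2 * ((j + j' : ℤ) : ℝ)) * Real.sqrt (2 / 3)) • n := by
    rw [hsm, hj', ht₁, hj, add_assoc, ← add_smul]
    congr 1; push_cast; ring
  refine ⟨hframe, horig, ?_⟩
  rw [hframe, horig, affLat_eq_iff]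
  have e : t - (t + ((2 * ((j + j' : ℤ) : ℝ)) * Real.sqrt (2 / 3)) • n) =
      ((2 * ((-(j + j') : ℤ) : ℝ)) * Real.sqrt (2 / 3)) • n := by
    rw [sub_add_eq_sub_sub, sub_self, zero_sub, ← neg_smul]
    congr 1; push_cast; ring
  rw [e, two_mul_sqrt_smul_menu_mem_iff hn hmenu]
  simp only [true_and, dvd_neg]

end ColumnWord

end Summit.Ventures.Crystal3D.Theorems

end
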